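import Summits.BirchSwinnertonDyer.BirchSwinnertonDyer.Theses.KatoDescentTamePotSupersingular
import Summits.BirchSwinnertonDyer.BirchSwinnertonDyer.Theorems.KatoDescentPotSupersingularReducibleKatoMemberOfFineInputsFW
import HarnessLib

/-!
# Crux M (K8-t′ `ReducibleKatoMember`), its HELD child 27962 `PublishedInputMemberHullZetaCore` and U₀-red's
# `PublishedInputKatoCorePackageU0RedT` BY NAME from {modularity, Fine, H2X⁺, FW} — the character form of Iwasawa's `μ = 0` is a tree
# theorem and no longer an input (route `KatoDescentTamePotSupersingular`; seat `bsd-potss-rkm` g34)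

Typed closers for tenure: the conclusions are the route's declarations BY NAME; the hypotheses are exactly the NAMED Literature facts
{`Kato2004.exists_memberHullZetaFineInputs` (hull sub-package), `Kato2004.exists_iwasawaH2Data_fineSelmerDual_embedding_count` (H2X⁺),
`IwasawaTheory.ferreroWashington1979_classicalMuVanishes`} plus modularity (`exists_isNewformOf`, or the route's live aliases).  g33's
`FineInputsCharFormKT` closers with their `hchar : classicalMuVanishes_finite_unramifiedClasses` DISCHARGED by
`IwasawaTheory.ClassicalMuVanishesUnramifiedClasses.classicalMuVanishes_finite_unramifiedClasses_holds` (g34).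

HONEST FRAMING: `--supports 19196 --as helper`; closes nothing by itself (crux M is cite-level over the HELD inputs Fine / H2X⁺ —
Kato's Euler-system theorems); BSD is proved for no curve; nothing is booked.

References: [Kato2004Asterisque] Thm. 12.5/12.6 (p. 222), Cor. 14.3, Thm. 14.5 (pp. 235–236), §14.9 (pp. 239–240), §14.14 (p. 243),
Prop. 14.16 (2) (pp. 244–245); [Wuthrich2014] Lemma 14; [CoatesSujatha2005] Cor. 3.6; [FerreroWashington1979]; [Washington1997] §13.3.
-/

-- the summit and its single problem are both named `BirchSwinnertonDyer` (registry layout D-0017)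
set_option linter.dupNamespace false
set_option autoImplicit false

noncomputable section

open Literature.NumberTheory.EllipticCurves Literature.NumberTheory.EllipticCurves.ModularForms
  Literature.NumberTheory.EllipticCurves.Kato2004 Literature.NumberTheory.IwasawaTheory
open Summit.BirchSwinnertonDyer.BirchSwinnertonDyer.Theorems

namespace Summit.BirchSwinnertonDyer.BirchSwinnertonDyer.Theorems.FineInputsFWKT

/-- **The HELD child 27962 `PublishedInputMemberHullZetaCore` BY NAME from the hull sub-package, H2X⁺, and FW — char-form `μ = 0` DISCHARGED.** [cite: Kato2004Asterisque, Thm. 12.5 (3) (p. 222), (14.9.1) (p. 239), (14.9.3) (p. 240), §14.14 (14.14.1)–(14.14.2) (p. 243)]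
[cite: CoatesSujatha2005, Cor. 3.6] -/
theorem publishedInputMemberHullZetaCore_of_fineInputs_of_FW (hF : exists_memberHullZetaFineInputs)
    (hH : exists_iwasawaH2Data_fineSelmerDual_embedding_count)
    (hFW : ferreroWashington1979_classicalMuVanishes) :
    Summit.BirchSwinnertonDyer.BirchSwinnertonDyer.Theses.KatoDescentTamePotSupersingular.PublishedInputMemberHullZetaCore :=
  FineInputsFW.exists_memberHullZetaCoreInputs_of_fineInputs_of_FW hF hH hFW

/-- **U₀-red's copy `PublishedInputKatoCorePackageU0RedT` (the same constant) BY NAME from the same three facts.**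
[cite: Kato2004Asterisque, §14.14 (14.14.1)–(14.14.2) (p. 243), proof of Prop. 14.16 (2) (pp. 244–245)] [cite: CoatesSujatha2005, Cor. 3.6] -/
theorem publishedInputKatoCorePackageU0RedT_of_fineInputs_of_FW (hF : exists_memberHullZetaFineInputs)
    (hH : exists_iwasawaH2Data_fineSelmerDual_embedding_count)
    (hFW : ferreroWashington1979_classicalMuVanishes) :
    Summit.BirchSwinnertonDyer.BirchSwinnertonDyer.Theses.KatoDescentTamePotSupersingular.PublishedInputKatoCorePackageU0RedT :=
  FineInputsFW.exists_memberHullZetaCoreInputs_of_fineInputs_of_FW hF hH hFW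

/-- **Crux M (`ReducibleKatoMember`) from modularity, the hull sub-package, H2X⁺ and FW, Literature-constant
form — no Lim, no Imai, no character-form named fact, no Gross–Zagier–Kolyvagin, no Poitou–Tate binder, no abstract `𝐇²`.**
[cite: Kato2004Asterisque, Thm. 12.5/12.6 (p. 222), Cor. 14.3, Thm. 14.5 (pp. 235–236), (14.9.1)–(14.9.3) (pp. 239–240), (14.14.1)–(14.14.2) (p. 243), Prop. 14.16 (2) (pp. 244–245)]
[cite: Wuthrich2014, Lemma 14 (p. 396)] -/
theorem tameReducibleKatoMember_of_newform_of_fineInputs_of_FW (hmod : exists_isNewformOf)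
    (hF : exists_memberHullZetaFineInputs) (hH : exists_iwasawaH2Data_fineSelmerDual_embedding_count)
    (hFW : ferreroWashington1979_classicalMuVanishes) :
    Summit.BirchSwinnertonDyer.BirchSwinnertonDyer.Theses.KatoDescentTamePotSupersingular.ReducibleKatoMember :=
  FineInputsFW.katoMemberShaBoundOfReducible_of_newform_of_fineInputs_of_FW hmod hF hH hFW

/-- **Crux M keyed to the live alias `PublishedInputNewformKatoZ`** (through its modularity conjunct) and the three facts.
[cite: Kato2004Asterisque, Cor. 14.3, Thm. 14.5 (pp. 235–236), Prop. 14.16 (2) (pp. 244–245)] [cite: BreuilConradDiamondTaylor2001, Thm. A] -/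
theorem tameReducibleKatoMember_of_newformZ_of_fineInputs_of_FW
    (hmod : Summit.BirchSwinnertonDyer.BirchSwinnertonDyer.Theses.KatoDescentTamePotSupersingular.PublishedInputNewformKatoZ)
    (hF : exists_memberHullZetaFineInputs) (hH : exists_iwasawaH2Data_fineSelmerDual_embedding_count)
    (hFW : ferreroWashington1979_classicalMuVanishes) :
    Summit.BirchSwinnertonDyer.BirchSwinnertonDyer.Theses.KatoDescentTamePotSupersingular.ReducibleKatoMember :=
  tameReducibleKatoMember_of_newform_of_fineInputs_of_FW hmod hF hH hFW

/-- **Crux M keyed to U₀-red's live modularity alias `PublishedInputModularityU0RedT`** and the three facts.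
[cite: Kato2004Asterisque, Prop. 14.16 (2) (pp. 244–245)] [cite: BreuilConradDiamondTaylor2001, Thm. A] -/
theorem tameReducibleKatoMember_of_modularityU0RedT_of_fineInputs_of_FW
    (hmod : Summit.BirchSwinnertonDyer.BirchSwinnertonDyer.Theses.KatoDescentTamePotSupersingular.PublishedInputModularityU0RedT)
    (hF : exists_memberHullZetaFineInputs) (hH : exists_iwasawaH2Data_fineSelmerDual_embedding_count)
    (hFW : ferreroWashington1979_classicalMuVanishes) :
    Summit.BirchSwinnertonDyer.BirchSwinnertonDyer.Theses.KatoDescentTamePotSupersingular.ReducibleKatoMember :=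
  tameReducibleKatoMember_of_newform_of_fineInputs_of_FW hmod hF hH hFW

end Summit.BirchSwinnertonDyer.BirchSwinnertonDyer.Theorems.FineInputsFWKT

end
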